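import Mathlib
import Summits.ABC.ABC.Theorems.SolvedZooCohnOddExponentLemmas
import Summits.ABC.ABC.Theorems.SolvedZooCohnOddExponentPell

/-!
# Cohn 1996, «Perfect Pell powers», LEMMA — odd exponent: `y² + 1 = 2 z^{2K+1}`, `K ≥ 1` ⇒ `z = 1`

J. H. E. Cohn, *Perfect Pell powers*, Glasgow Math. J. **38** (1996) 19–20, LEMMA: «the Diophantine
equation `y² − 2 z^k = −1` with `k > 2` has only the solutions `y = z = 1` and `y = 239, z = 13, k = 4`».
This file assembles the ODD-EXPONENT half (`k = 2K+1 ≥ 3`), whose printed proof is self-contained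
(Ljunggren 1942 is invoked by Cohn only for `4 ∣ k`):

* (A) `cohn_exists_sq_add_one_eq_two_mul` (file `SolvedZooCohnOddExponentLemmas`, seat abc-inputs-pr-3):
  Gaussian-integer descent, `y + i = (1+i)(a+bi)^{2K+1}`, `a ± b = ±1`, hence `2z = c² + 1`;
* (B) `cohn_negPell_structure`, (C) `cohn_pow_dvd_index`, (D) `cohn_index_lt_sum`
  (file `SolvedZooCohnOddExponentPell`): `y² − (c²+1)(z^K)² = −1` forces `z^K = V_m`,
  the `p`-adic comparison gives `z^K ∣ 2m+1`, and `V_m > 2m+1` unless `m = 0`;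
* (E) here: `m = 0`, so `z^K = V_0 = 1`, `z = 1`.

Input row I-03 (odd half) of `pub/abc-inputs/INPUTS-LIST.md`, consumer: the inline hypothesis `hPellPow` of
`SolvedZooABC` (stmt-ABC-24025, route ThreeSlotCyclotomicDescent, family (ii) `X² + 1 = 2Y²`, `Y = t^k`):
`cohn1996_pell_power_odd_part` below settles every `k` with an odd prime factor; the remaining case
`k = 2^j` is Ljunggren's quartic `x² + 1 = 2y⁴` (named fact, NOT proved here) — so family (ii) stays
PROVED-MOD-FACT {ljunggren1942}. HONESTY: proving this printed input makes a conditional line unconditional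
AS TYPED; it is not abc, and abc moved by 0. PROOF-ONLY file: no definition, no named fact, no `sorry`.
[cite: paper:cohn1996-perfect-pell-powers, Lemma, p. 19–20]
-/

set_option linter.dupNamespace false

namespace Summit.ABC.ABC.Theorems

/-- **Cohn 1996, LEMMA (odd exponent).** If `y² + 1 = 2 z^{2K+1}` with `K ≥ 1` and `z > 0`, then `z = 1`
(Glasgow Math. J. 38, p. 19 l. −9 – p. 20 l. 13). -/
theorem cohn1996_lemma_odd {y z : ℤ} {K : ℕ} (hK : 1 ≤ K) (hz : 0 < z)
    (h : y ^ 2 + 1 = 2 * z ^ (2 * K + 1)) : z = 1 := by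
  obtain ⟨c, hc⟩ := cohn_exists_sq_add_one_eq_two_mul hz h
  -- move to `ℕ`
  obtain ⟨z', rfl⟩ : ∃ z' : ℕ, z = z' := ⟨z.toNat, (Int.toNat_of_nonneg hz.le).symm⟩
  set c' : ℕ := c.natAbs with hc'
  have hcc : (c' : ℤ) ^ 2 = c ^ 2 := by rw [hc']; exact Int.natAbs_pow_two c
  have hz' : 2 * z' = c' ^ 2 + 1 := by
    have : (2 * z' : ℤ) = (c' : ℤ) ^ 2 + 1 := by rw [hcc]; linarith
    exact_mod_cast this
  have hc1 : 1 ≤ c' := by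
    rcases Nat.eq_zero_or_pos c' with h0 | h0
    · rw [h0] at hz'; omega
    · exact h0
  have hv : 1 ≤ z' ^ K := Nat.one_le_pow _ _ (by omega)
  -- `y² − (c'² + 1) (z'^K)² = −1`
  have hB : y ^ 2 + 1 = ((c' : ℤ) ^ 2 + 1) * ((z' ^ K : ℕ) : ℤ) ^ 2 := by
    rw [hcc, hc, h]; push_cast; ring
  obtain ⟨m, hm⟩ := cohn_negPell_structure hc1 hv hB
  rw [← hz'] at hm
  have hdvd : z' ^ K ∣ 2 * m + 1 := cohn_pow_dvd_index hz' hm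
  rcases Nat.eq_zero_or_pos m with hm0 | hm0
  · -- `m = 0`: `z'^K = V_0 = 1`
    subst hm0
    simp at hm
    have : z' = 1 := by
      rcases hm with h1 | h1
      · exact h1
      · omega
    simp [this]
  · -- `m ≥ 1`: `z'^K ∣ 2m+1 < V_m = z'^K`, absurd
    have hlt := cohn_index_lt_sum hc1 (show 1 ≤ 2 * z' by omega) hm0
    rw [← hm] at hlt
    have := Nat.le_of_dvd (by omega) hdvd
    omega

/-- The same without the sign hypothesis on `z` (an odd power of a non-positive integer is `≤ 0 < y² + 1`). -/
theorem cohn1996_lemma_odd' {y z : ℤ} {K : ℕ} (hK : 1 ≤ K) (h : y ^ 2 + 1 = 2 * z ^ (2 * K + 1)) :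
    z = 1 := by
  refine cohn1996_lemma_odd hK ?_ h
  by_contra hz
  push Not at hz
  have : z ^ (2 * K + 1) ≤ 0 := (odd_two_mul_add_one K).pow_nonpos hz
  nlinarith [sq_nonneg y]

/-- **Cohn 1996, LEMMA, odd exponent `n ≥ 3`:** `y² + 1 = 2 zⁿ`, `n` odd, `n ≥ 3` ⇒ `z = 1`. -/
theorem cohn1996_lemma_odd_of_odd {y z : ℤ} {n : ℕ} (hn : Odd n) (h3 : 3 ≤ n)
    (h : y ^ 2 + 1 = 2 * z ^ n) : z = 1 := by
  obtain ⟨K, rfl⟩ := hn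
  exact cohn1996_lemma_odd' (K := K) (by omega) h

/-- `ℕ` version of Cohn's odd-exponent lemma: `y² + 1 = 2 z^{2K+1}`, `K ≥ 1` ⇒ `z = 1`. -/
theorem cohn1996_lemma_odd_nat {y z K : ℕ} (hK : 1 ≤ K) (h : y ^ 2 + 1 = 2 * z ^ (2 * K + 1)) :
    z = 1 := by
  have h' : (y : ℤ) ^ 2 + 1 = 2 * (z : ℤ) ^ (2 * K + 1) := by exact_mod_cast h
  exact_mod_cast cohn1996_lemma_odd' hK h'

/-- **Consumer form for `hPellPow` of `SolvedZooABC` (family (ii), odd part).** If `X² + 1 = 2 Y²` with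
`Y = t^k`, `t > 0`, and `k` has an odd divisor `q ≥ 3`, then `t = 1`. (So a Pell `Y` that is a perfect
`k`-th power with `t ≥ 2` has `k` a power of two; the case `k = 2^j`, `j ≥ 1`, is Ljunggren's quartic
`x² + 1 = 2 y⁴`, not proved here.) -/
theorem cohn1996_pell_power_odd_part {X t : ℤ} {k q : ℕ} (hq : Odd q) (hq3 : 3 ≤ q) (hqk : q ∣ k)
    (hk : 1 ≤ k) (ht : 0 < t) (h : X ^ 2 + 1 = 2 * (t ^ k) ^ 2) : t = 1 := by
  obtain ⟨k', rfl⟩ := hqk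
  have hk' : k' ≠ 0 := by rintro rfl; simp at hk
  have hpow : (t ^ (q * k')) ^ 2 = (t ^ (2 * k')) ^ q := by
    rw [← pow_mul, ← pow_mul]; ring_nf
  rw [hpow] at h
  have h1 : t ^ (2 * k') = 1 := cohn1996_lemma_odd_of_odd hq hq3 h
  exact (pow_eq_one_iff_of_nonneg ht.le (by omega)).1 h1

/-- Cohn 1996, p. 19 («`k` must have an odd prime factor, and so may be taken odd») turned around:
in `X² + 1 = 2 (t^k)²` with `t ≥ 2` and `k ≥ 1`, the exponent `k` is a power of two
(write `k = 2^a · b` with `b` odd; `b ≥ 3` is excluded by `cohn1996_pell_power_odd_part`). So for the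
consumer `hPellPow` only the quartic case `X² + 1 = 2 (t^{k/2})⁴` (Ljunggren 1942, named fact) remains. -/
theorem cohn1996_pell_power_exponent_two_pow {X t : ℤ} {k : ℕ} (hk : 1 ≤ k) (ht : 2 ≤ t)
    (h : X ^ 2 + 1 = 2 * (t ^ k) ^ 2) : ∃ j : ℕ, k = 2 ^ j := by
  obtain ⟨a, b, hb, hab⟩ := Nat.exists_eq_two_pow_mul_odd (by omega : k ≠ 0)
  rcases Nat.lt_or_ge b 3 with hb3 | hb3
  · obtain ⟨r, rfl⟩ := hb
    have hr : r = 0 := by omega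
    subst hr
    exact ⟨a, by simpa using hab⟩
  · exfalso
    have hbk : b ∣ k := ⟨2 ^ a, by rw [hab, mul_comm]⟩
    have := cohn1996_pell_power_odd_part hb hb3 hbk hk (by omega) h
    omega

/-- `ℕ` version of `cohn1996_pell_power_exponent_two_pow`: in `X² + 1 = 2 (t^k)²` with `t ≥ 2`, `k ≥ 1`
(all in `ℕ`), `k` is a power of two. -/
theorem cohn1996_pell_power_exponent_two_pow_nat {X t k : ℕ} (hk : 1 ≤ k) (ht : 2 ≤ t)
    (h : X ^ 2 + 1 = 2 * (t ^ k) ^ 2) : ∃ j : ℕ, k = 2 ^ j :=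
  cohn1996_pell_power_exponent_two_pow (X := (X : ℤ)) (t := (t : ℤ)) hk (by exact_mod_cast ht)
    (by exact_mod_cast h)

end Summit.ABC.ABC.Theorems
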